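import Mathlib.NumberTheory.Padics.RingHoms
import Literature.NumberTheory.EllipticCurves.TwoDescentLocalOdd
import HarnessLib

/-!
# Local data of the complete `2`-descent over `ℚ` at `p = 2`: residues modulo `8`

Companion of `TwoDescentLocalOdd.lean`. The square class of a non-zero `2`-adic number is given by
the parity of its valuation and the residue modulo `8` of its unit part
(`ℚ₂*/ℚ₂*² ≅ ℤ/2 × (ℤ/8)*`, Silverman, *AEC*, X.1, Example X.1.5). For RATIONAL numbers we
define this data without leaving `ℚ` in the statements: the residue `resPow p n a ∈ ℤ/pⁿ` of the
`p`-unit part of `a ∈ ℚ` through Mathlib's `PadicInt.toZModPow` (a ring homomorphism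
`ℤ_p → ℤ/pⁿ`, which makes `resPow` multiplicative and gives the ultrametric rule
`resPow (a + b) = resPow a + p^k resPow b` when `v_p(b) = v_p(a) + k`, `k ≥ 1`), and for
`p = 2`, `n = 3` the two characters of `(ℤ/8)*`:

* `chi4 a` (`1` iff the unit part is `≡ 3 (mod 4)`) and `chi8 a` (`1` iff it is `≡ ±3 (mod 8)`),
  additive on products, trivial on squares, whence characters
  `chi4Hom, chi8Hom : Additive (ℚ*/ℚ*²) →+ ℤ/2` (companions of the tree's `signHom`, `parityHom p`,
  `qrHom p`); together with `parityHom 2` they separate `ℚ₂*/ℚ₂*²`.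

Everything is proved; only rational numbers occur in the statements.

## References

* J. H. Silverman, *The Arithmetic of Elliptic Curves*, 2nd ed., GTM 106 (2009), X.1
  (Prop. X.1.4, Example X.1.5). [SilvermanAEC2009]
-/

noncomputable section

open scoped Classical

open WeierstrassCurve.Affine

namespace Literature.NumberTheory.EllipticCurves.TwoDescentLocal

open Literature.NumberTheory.EllipticCurves.KramerTwoDescent

section General

variable (p : ℕ) [hp : Fact p.Prime]

/-- The unit part of a rational is `p`-integral in `ℚ_p`. [folklore] -/
theorem norm_unitPart_le_one (a : ℚ) : ‖((unitPart p a : ℚ) : ℚ_[p])‖ ≤ 1 := by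
  by_cases ha : a = 0
  · rw [ha, unitPart, zero_div, Rat.cast_zero, norm_zero]; exact zero_le_one
  · exact Padic.norm_rat_le_one (not_dvd_den_of_padicValRat_eq_zero (padicValRat_unitPart p ha))

/-- The unit part of `a`, as a `p`-adic integer. [folklore] -/
def unitPartInt (a : ℚ) : ℤ_[p] := ⟨((unitPart p a : ℚ) : ℚ_[p]), norm_unitPart_le_one p a⟩

/-- **The residue modulo `pⁿ` of the `p`-unit part of a rational** (`0 ↦ 0`). [folklore] -/
def resPow (n : ℕ) (a : ℚ) : ZMod (p ^ n) := PadicInt.toZModPow n (unitPartInt p a)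

/-- `unitPartInt` is multiplicative. [folklore] -/
theorem unitPartInt_mul {a b : ℚ} (ha : a ≠ 0) (hb : b ≠ 0) :
    unitPartInt p (a * b) = unitPartInt p a * unitPartInt p b := by
  apply PadicInt.ext
  simp [unitPartInt, unitPart_mul p ha hb, PadicInt.coe_mul]

/-- `unitPartInt 1 = 1`. [folklore] -/
theorem unitPartInt_one : unitPartInt p 1 = 1 := by
  apply PadicInt.ext
  simp [unitPartInt, unitPart_of_eq_zero p (padicValRat.one (p := p)), PadicInt.coe_one]

/-- **`resPow` is multiplicative** (on non-zero rationals). [folklore] -/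
theorem resPow_mul (n : ℕ) {a b : ℚ} (ha : a ≠ 0) (hb : b ≠ 0) :
    resPow p n (a * b) = resPow p n a * resPow p n b := by
  rw [resPow, unitPartInt_mul p ha hb, map_mul]; rfl

/-- `resPow 1 = 1`. [folklore] -/
theorem resPow_one (n : ℕ) : resPow p n 1 = 1 := by
  rw [resPow, unitPartInt_one, map_one]

/-- The residue of a non-zero rational is invertible, with inverse the residue of the inverse.
[folklore] -/
theorem resPow_mul_resPow_inv (n : ℕ) {a : ℚ} (ha : a ≠ 0) :
    resPow p n a * resPow p n a⁻¹ = 1 := by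
  rw [← resPow_mul p n ha (inv_ne_zero ha), mul_inv_cancel₀ ha, resPow_one]

/-- Shifting by a power of `p` does not change the unit part. [folklore] -/
theorem unitPart_zpow_mul (k : ℤ) {a : ℚ} (ha : a ≠ 0) :
    unitPart p ((p : ℚ) ^ k * a) = unitPart p a := by
  have hp0 : (p : ℚ) ≠ 0 := Nat.cast_ne_zero.mpr hp.out.ne_zero
  rw [unitPart, unitPart, padicValRat.mul (zpow_ne_zero _ hp0) ha, padicValRat.zpow,
    padicValRat.self hp.out.one_lt, mul_one, zpow_add₀ hp0]
  field_simp

/-- Shifting by a power of `p` does not change the residue. [folklore] -/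
theorem resPow_zpow_mul (n : ℕ) (k : ℤ) {a : ℚ} (ha : a ≠ 0) :
    resPow p n ((p : ℚ) ^ k * a) = resPow p n a := by
  simp only [resPow, unitPartInt, unitPart_zpow_mul p k ha]

/-- The residue of an integer prime to `p` is its reduction. [folklore] -/
theorem resPow_intCast (n : ℕ) {z : ℤ} (hz : ¬ (p : ℤ) ∣ z) :
    resPow p n z = (z : ZMod (p ^ n)) := by
  have h : unitPartInt p z = (z : ℤ_[p]) := by
    apply PadicInt.ext
    simp [unitPartInt, unitPart_of_eq_zero p (padicValRat_intCast_eq_zero hz), PadicInt.coe_intCast]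
  rw [resPow, h, map_intCast]

/-- **Ultrametric residues**: if `v_p(b) = v_p(a) + k` with `k ≥ 1` (`a ≠ 0`), then
`resPow (a + b) = resPow a + p^k · resPow b` in `ℤ/pⁿ`. [folklore] -/
theorem resPow_add_of_eq (n : ℕ) {a b : ℚ} (ha : a ≠ 0) {k : ℕ} (hk : 1 ≤ k)
    (h : padicValRat p b = padicValRat p a + k) :
    resPow p n (a + b) = resPow p n a + (p : ZMod (p ^ n)) ^ k * resPow p n b := by
  have hp0 : (p : ℚ) ≠ 0 := Nat.cast_ne_zero.mpr hp.out.ne_zero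
  obtain ⟨_, hv⟩ := padicValRat_add_eq_left (p := p) ha (b := b) (Or.inr (by omega))
  -- unit parts: `u(a + b) = u(a) + p^k u(b)`
  have hu : unitPart p (a + b) = unitPart p a + (p : ℚ) ^ k * unitPart p b := by
    rw [unitPart, unitPart, unitPart, hv, h, zpow_add₀ hp0, zpow_natCast]
    field_simp
  have hI : unitPartInt p (a + b) = unitPartInt p a + (p : ℤ_[p]) ^ k * unitPartInt p b := by
    apply PadicInt.ext
    simp [unitPartInt, hu, PadicInt.coe_add, PadicInt.coe_mul, PadicInt.coe_pow, PadicInt.coe_natCast]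
  rw [resPow, hI, map_add, map_mul, map_pow, map_natCast]; rfl

/-- The residue of a square is a square: `resPow (c²) = (resPow c)²`. [folklore] -/
theorem resPow_sq (n : ℕ) (c : ℚ) : resPow p n (c ^ 2) = resPow p n c ^ 2 := by
  by_cases hc : c = 0
  · subst hc
    have : unitPartInt p 0 = 0 := by
      apply PadicInt.ext; simp [unitPartInt, unitPart, PadicInt.coe_zero]
    simp [resPow, this]
  · rw [sq, sq, resPow_mul p n hc hc]

/-- `resPow 0 = 0`. [folklore] -/
theorem resPow_zero (n : ℕ) : resPow p n 0 = 0 := by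
  have : unitPartInt p 0 = 0 := by
    apply PadicInt.ext; simp [unitPartInt, unitPart, PadicInt.coe_zero]
  simp [resPow, this]

/-- A rational `p`-unit: its residue times its denominator is its numerator. [folklore] -/
theorem resPow_mul_den (n : ℕ) {a : ℚ} (h : padicValRat p a = 0) :
    resPow p n a * (a.den : ZMod (p ^ n)) = (a.num : ZMod (p ^ n)) := by
  have hI : unitPartInt p a * (a.den : ℤ_[p]) = (a.num : ℤ_[p]) := by
    apply PadicInt.ext
    rw [PadicInt.coe_mul, PadicInt.coe_natCast, PadicInt.coe_intCast]
    simp only [unitPartInt, unitPart_of_eq_zero p h]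
    rw [← Rat.cast_natCast, ← Rat.cast_intCast, ← Rat.cast_mul, Rat.mul_den_eq_num]
  have := congrArg (PadicInt.toZModPow n) hI
  rw [map_mul, map_natCast, map_intCast] at this
  exact this

end General

/-! ### `p = 2`: residues modulo `8` and the characters `chi4`, `chi8` -/

/-- The residue modulo `8 = 2³` of the odd part of a rational. [folklore] -/
abbrev res8 (a : ℚ) : ZMod (2 ^ 3) := resPow 2 3 a

/-- Finite facts about `ℤ/8`: inverses and the odd classes. [folklore] -/
theorem zmod8_aux :
    (∀ r s : ZMod (2 ^ 3), r * s = 1 → r * r = 1) ∧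
    (∀ r : ZMod (2 ^ 3), r * r = 1 → (r = 1 ∨ r = 3 ∨ r = 5 ∨ r = 7)) := by
  refine ⟨by decide, by decide⟩

/-- The residue mod `8` of a non-zero rational is an odd class: `r² = 1`. [folklore] -/
theorem res8_mul_self {a : ℚ} (ha : a ≠ 0) : res8 a * res8 a = 1 :=
  zmod8_aux.1 _ _ (resPow_mul_resPow_inv 2 3 ha)

/-- `res8` is multiplicative (on non-zero rationals). [folklore] -/
theorem res8_mul {a b : ℚ} (ha : a ≠ 0) (hb : b ≠ 0) : res8 (a * b) = res8 a * res8 b :=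
  resPow_mul 2 3 ha hb

/-- `res8 (c²) = (res8 c)²`. [folklore] -/
theorem res8_sq (c : ℚ) : res8 (c ^ 2) = res8 c ^ 2 := resPow_sq 2 3 c

/-- `res8` of an odd integer is its reduction mod `8`. [folklore] -/
theorem res8_intCast {z : ℤ} (hz : ¬ (2 : ℤ) ∣ z) : res8 (z : ℚ) = (z : ZMod (2 ^ 3)) :=
  resPow_intCast 2 3 (by exact_mod_cast hz)

/-- `res8` ignores powers of `2`. [folklore] -/
theorem res8_two_zpow_mul (k : ℤ) {a : ℚ} (ha : a ≠ 0) : res8 ((2 : ℚ) ^ k * a) = res8 a := by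
  have := resPow_zpow_mul 2 3 k ha
  rw [Nat.cast_ofNat] at this
  exact this

/-- **Ultrametric residues mod `8`**: if `v₂(b) = v₂(a) + k`, `k ≥ 1`, `a ≠ 0`, then
`res8 (a + b) = res8 a + 2^k res8 b`. [folklore] -/
theorem res8_add_of_eq {a b : ℚ} (ha : a ≠ 0) {k : ℕ} (hk : 1 ≤ k)
    (h : padicValRat 2 b = padicValRat 2 a + k) :
    res8 (a + b) = res8 a + (2 : ZMod (2 ^ 3)) ^ k * res8 b := by
  have := resPow_add_of_eq 2 3 ha hk h
  rw [Nat.cast_ofNat] at this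
  exact this

/-- The bit `χ₋₁` as a function of an odd residue mod `8`: `1` on `3, 7`. [folklore] -/
def chi4Of (r : ZMod (2 ^ 3)) : ZMod 2 := if r = 3 ∨ r = 7 then 1 else 0

/-- The bit `χ₂` as a function of an odd residue mod `8`: `1` on `3, 5`. [folklore] -/
def chi8Of (r : ZMod (2 ^ 3)) : ZMod 2 := if r = 3 ∨ r = 5 then 1 else 0

/-- `chi4 a = 1` iff the odd part of `a` is `≡ 3 (mod 4)`. [folklore] -/
def chi4 (a : ℚ) : ZMod 2 := chi4Of (res8 a)

/-- `chi8 a = 1` iff the odd part of `a` is `≡ ±3 (mod 8)`. [folklore] -/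
def chi8 (a : ℚ) : ZMod 2 := chi8Of (res8 a)

/-- Additivity of the bits on odd classes (finite check on `(ℤ/8)*`). [folklore] -/
theorem chiOf_mul_aux :
    (∀ r s : ZMod (2 ^ 3), r * r = 1 → s * s = 1 → chi4Of (r * s) = chi4Of r + chi4Of s) ∧
    (∀ r s : ZMod (2 ^ 3), r * r = 1 → s * s = 1 → chi8Of (r * s) = chi8Of r + chi8Of s) := by
  refine ⟨by decide, by decide⟩

/-- `chi4` is additive on products. [folklore] -/
theorem chi4_mul {a b : ℚ} (ha : a ≠ 0) (hb : b ≠ 0) : chi4 (a * b) = chi4 a + chi4 b := by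
  rw [chi4, chi4, chi4, show res8 (a * b) = res8 a * res8 b from resPow_mul 2 3 ha hb]
  exact chiOf_mul_aux.1 _ _ (res8_mul_self ha) (res8_mul_self hb)

/-- `chi8` is additive on products. [folklore] -/
theorem chi8_mul {a b : ℚ} (ha : a ≠ 0) (hb : b ≠ 0) : chi8 (a * b) = chi8 a + chi8 b := by
  rw [chi8, chi8, chi8, show res8 (a * b) = res8 a * res8 b from resPow_mul 2 3 ha hb]
  exact chiOf_mul_aux.2 _ _ (res8_mul_self ha) (res8_mul_self hb)

/-- `chi4` kills squares. [folklore] -/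
theorem chi4_mul_self (a : ℚ) : chi4 (a * a) = 0 := by
  by_cases ha : a = 0
  · rw [ha, mul_zero, chi4, show res8 0 = 0 from resPow_zero 2 3]
    decide
  · rw [chi4_mul ha ha]
    generalize chi4 a = t
    revert t
    decide

/-- `chi8` kills squares. [folklore] -/
theorem chi8_mul_self (a : ℚ) : chi8 (a * a) = 0 := by
  by_cases ha : a = 0
  · rw [ha, mul_zero, chi8, show res8 0 = 0 from resPow_zero 2 3]
    decide
  · rw [chi8_mul ha ha]
    generalize chi8 a = t
    revert t
    decide

/-- `chi4` on `ℚˣ`. [folklore] -/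
def chi4UnitsHom : ℚˣ →* Multiplicative (ZMod 2) where
  toFun u := Multiplicative.ofAdd (chi4 (u : ℚ))
  map_one' := by
    rw [Units.val_one, show (1 : ℚ) = 1 * 1 from (mul_one 1).symm, chi4_mul_self, ofAdd_zero]
  map_mul' u v := by rw [Units.val_mul, chi4_mul u.ne_zero v.ne_zero, ofAdd_add]

/-- `chi8` on `ℚˣ`. [folklore] -/
def chi8UnitsHom : ℚˣ →* Multiplicative (ZMod 2) where
  toFun u := Multiplicative.ofAdd (chi8 (u : ℚ))
  map_one' := by
    rw [Units.val_one, show (1 : ℚ) = 1 * 1 from (mul_one 1).symm, chi8_mul_self, ofAdd_zero]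
  map_mul' u v := by rw [Units.val_mul, chi8_mul u.ne_zero v.ne_zero, ofAdd_add]

/-- Squares lie in the kernel of `chi4UnitsHom`. [folklore] -/
theorem range_powMonoidHom_le_ker_chi4UnitsHom :
    (powMonoidHom 2 : ℚˣ →* ℚˣ).range ≤ chi4UnitsHom.ker := by
  rintro _ ⟨u, rfl⟩
  rw [MonoidHom.mem_ker, powMonoidHom_apply]
  simp only [chi4UnitsHom, MonoidHom.coe_mk, OneHom.coe_mk, sq, Units.val_mul, chi4_mul_self,
    ofAdd_zero]

/-- Squares lie in the kernel of `chi8UnitsHom`. [folklore] -/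
theorem range_powMonoidHom_le_ker_chi8UnitsHom :
    (powMonoidHom 2 : ℚˣ →* ℚˣ).range ≤ chi8UnitsHom.ker := by
  rintro _ ⟨u, rfl⟩
  rw [MonoidHom.mem_ker, powMonoidHom_apply]
  simp only [chi8UnitsHom, MonoidHom.coe_mk, OneHom.coe_mk, sq, Units.val_mul, chi8_mul_self,
    ofAdd_zero]

/-- **The character `χ₋₁` of `ℚ*/ℚ*²`**: `1` iff the odd part is `≡ 3 (mod 4)`. [folklore] -/
def chi4Hom : Additive (SqUnits ℚ) →+ ZMod 2 :=
  MonoidHom.toAdditiveLeft (QuotientGroup.lift _ chi4UnitsHom range_powMonoidHom_le_ker_chi4UnitsHom)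

/-- **The character `χ₂` of `ℚ*/ℚ*²`**: `1` iff the odd part is `≡ ±3 (mod 8)`. [folklore] -/
def chi8Hom : Additive (SqUnits ℚ) →+ ZMod 2 :=
  MonoidHom.toAdditiveLeft (QuotientGroup.lift _ chi8UnitsHom range_powMonoidHom_le_ker_chi8UnitsHom)

/-- The value of `chi4Hom` on a square class. [folklore] -/
theorem chi4Hom_sqClass {a : ℚ} (ha : a ≠ 0) : chi4Hom (Additive.ofMul (sqClass a)) = chi4 a := by
  rw [sqClass_of_ne_zero ha, chi4Hom, MonoidHom.toAdditiveLeft]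
  simp [chi4UnitsHom]

/-- The value of `chi8Hom` on a square class. [folklore] -/
theorem chi8Hom_sqClass {a : ℚ} (ha : a ≠ 0) : chi8Hom (Additive.ofMul (sqClass a)) = chi8 a := by
  rw [sqClass_of_ne_zero ha, chi8Hom, MonoidHom.toAdditiveLeft]
  simp [chi8UnitsHom]

end Literature.NumberTheory.EllipticCurves.TwoDescentLocal

end
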